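import Mathlib
import HarnessLib
import Summits.HubbardSuperconductivity.HubbardSuperconductivity.Theorems.KLProgrammeC4aPPKernelSmoothPartition
import Summits.HubbardSuperconductivity.HubbardSuperconductivity.Theorems.KLProgrammeC4aPPKernelSplitFactor
import Summits.HubbardSuperconductivity.HubbardSuperconductivity.Theorems.KLProgrammeC4aPPKernelTrueKernelD2

/-!
# Route `KLProgramme` — crux C4a, S3 brick (B4) «(B4)-UMK1», «(U1)-M-LAW» kernel side: CALCULUS of the smooth comparable-levels piece
# `M(e,u) = P(e,u)·(1 − κ(r) − κ(1−r))`, `r = m̃(e)/(m̃(e)+m̃(u))`, `m̃(x) = √(x²+lo²)` — two partner derivatives, `C²`, and vanishing off the comparable zone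

Cell `gate-hubbard-kl`, seat hubbard-kl-k3c3-p1 (g17; row «δμ-flow with klAngularMean constant piece»).  Part 1 of the M-rows for k3c3-p3's «(U1)-M-LAW» (pen (R384)(A)(a):
«re-issue `M` with the smooth floor; rows `C²`-in-u, joint continuity of `∂ᵤM`, envelopes `hK0/hK1/hK2` in `max(|e|,|u|)`, comparability support both ways»;
objects `ppSmoothScale/ppSmoothRatio/ppMidKernelS` of `…C4aPPKernelSmoothPartition`, p704596).  Profile hypotheses (met by `ppSplitProfile t₁`): `κ ∈ C²`
(`HasDerivAt κ (κ′ t) t`, `HasDerivAt κ′ (κ″ t) t`, `κ″` continuous), `κ = 1` on `(−∞, t₁/2]`, `κ = 0` on `[t₁, ∞)` (and the same for `κ′, κ″` with value `0`), `0 < t₁ ≤ 2/5`.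
* §1 the floor and the ratio in the partner variable: `hasDerivAt_ppSmoothScale` (`m̃′ = u/m̃`), `hasDerivAt_div_ppSmoothScale` (`(u/m̃)′ = lo²/m̃³`),
  **`hasDerivAt_ppSmoothRatio_u`** (`r′ = −m̃ₑ(u/m̃ᵤ)/(m̃ₑ+m̃ᵤ)²`), **`hasDerivAt_ppSmoothRatioD1_u`** (`r″`), `abs_ppSmoothRatioD1_le` (`|r′| ≤ 1/(m̃ₑ+m̃ᵤ)`),
  `abs_ppSmoothRatioD2_le_of_scale` (`m̃ₑ ≤ q·m̃ᵤ ⟹ |r″| ≤ (q+2)/(m̃ₑ+m̃ᵤ)²`), `inv_ppSmoothScale_add_le_inv_max` (`1/(m̃ₑ+m̃ᵤ) ≤ (max |e| |u|)⁻¹`);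
* §2 the comparable zone `m̃ᵤ < q′m̃ₑ ∧ m̃ₑ < q′m̃ᵤ`, `q′ = (2−t₁)/t₁`: `ppSmoothRatio_gt_iff/_lt_iff`, `ppSmoothRatio_cases_of_not_comparable`, **`midFactor_eq_zero_of_not_comparable`**
  (off the zone the factor `1 − κ(r) − κ(1−r)` and `κ′(r), κ′(1−r)` vanish), `midFactorD2_eq_zero_of_not_comparable` (so do `κ″(r), κ″(1−r)`), `comparable_abs_lower` (`2q′lo ≤ e`, zone ⟹ `e/(2q′) ≤ |u|`), `not_comparable_of_ge`
  (`lo ≤ e`, `2q′e ≤ |u|` ⟹ off), `not_comparable_of_le` (`2q′lo ≤ e`, `2q′|u| ≤ e` ⟹ off);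
* §3 **`hasDerivAt_ppMidKernelS_u`** (`M′ = ∂ᵤP·m + P·(κ′(1−r) − κ′(r))r′`), **`hasDerivAt_ppMidKernelSD1_u`** (`M″ = ∂ᵤ²P·m + 2∂ᵤP·m′ + P·m″`),
  `deriv_ppMidKernelS_u`, `iteratedDeriv_two_ppMidKernelS_u`, **`contDiff_two_ppMidKernelS_u`** (the M-law's `hK`, every `e`),
  off the comparable zone `M′ = M″ = 0` by the formulas.
Part 2 (`…C4aPPKernelMidRows`): envelopes, comparability rows, joint continuity.  Pure real analysis; nothing asserts (C), K3, the window or superconductivity.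
References: BGM 2006 §2.4 (2.36) [cite: BenfattoGiulianiMastropietro2006]; FST II CPAM 51 (1998) §3 [cite: FeldmanSalmhoferTrubowitz1998].
-/

noncomputable section

namespace Summit.HubbardSuperconductivity.HubbardSuperconductivity.Theorems.C4a

set_option linter.dupNamespace false -- summit = problem name (single-conjunct summit), D-0017

open Real Filter Set
open scoped Topology
open Literature.MathematicalPhysics.QuantumLattice Literature.Analysis.SpecialFunctions

/-! ## §1 The smooth floor and the ratio in the partner variable -/

/-- `m̃′(u) = u/m̃(u)`. [folklore] -/
theorem hasDerivAt_ppSmoothScale {lo : ℝ} (hlo : 0 < lo) (u : ℝ) : HasDerivAt (ppSmoothScale lo) (u / ppSmoothScale lo u) u := by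
  unfold ppSmoothScale
  have h0 : HasDerivAt (fun v : ℝ => v ^ 2 + lo ^ 2) (2 * u) u := by
    refine ((hasDerivAt_pow 2 u).add_const (lo ^ 2)).congr_deriv ?_
    simp
  refine (h0.sqrt (by positivity)).congr_deriv ?_
  field_simp

/-- `(u/m̃(u))′ = lo²/m̃(u)³`. [folklore] -/
theorem hasDerivAt_div_ppSmoothScale {lo : ℝ} (hlo : 0 < lo) (u : ℝ) :
    HasDerivAt (fun v : ℝ => v / ppSmoothScale lo v) (lo ^ 2 / ppSmoothScale lo u ^ 3) u := by
  have hm := ppSmoothScale_pos hlo u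
  have h := (hasDerivAt_id u).div (hasDerivAt_ppSmoothScale hlo u) hm.ne'
  refine h.congr_deriv ?_
  have hsq : ppSmoothScale lo u ^ 2 = u ^ 2 + lo ^ 2 := by
    unfold ppSmoothScale; rw [Real.sq_sqrt (by positivity)]
  field_simp
  simp only [id]
  nlinarith [hsq]

/-- `|u/m̃(u)| ≤ 1`. [folklore] -/
theorem abs_div_ppSmoothScale_le_one {lo : ℝ} (hlo : 0 < lo) (u : ℝ) : |u / ppSmoothScale lo u| ≤ 1 := by
  have hm := ppSmoothScale_pos hlo u
  rw [abs_div, abs_of_pos hm, div_le_one hm]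
  exact abs_le_ppSmoothScale lo u

/-- `m̃(x)² = x² + lo²`. [folklore] -/
theorem ppSmoothScale_sq (lo x : ℝ) : ppSmoothScale lo x ^ 2 = x ^ 2 + lo ^ 2 := by unfold ppSmoothScale; rw [Real.sq_sqrt (by positivity)]

/-- `lo²/m̃(u)³ ≤ 1/m̃(u)`. [folklore] -/
theorem lo_sq_div_ppSmoothScale_cube_le {lo : ℝ} (hlo : 0 < lo) (u : ℝ) : lo ^ 2 / ppSmoothScale lo u ^ 3 ≤ 1 / ppSmoothScale lo u := by
  have hm := ppSmoothScale_pos hlo u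
  have hl := le_ppSmoothScale hlo.le u
  rw [div_le_div_iff₀ (by positivity) hm]
  have : lo ^ 2 ≤ ppSmoothScale lo u ^ 2 := pow_le_pow_left₀ hlo.le hl 2
  nlinarith [this, hm]

/-- **`r′(u) = −m̃ₑ·(u/m̃ᵤ)/(m̃ₑ+m̃ᵤ)²`** (`r(e,u) = m̃ₑ/(m̃ₑ+m̃ᵤ)`). [folklore] -/
theorem hasDerivAt_ppSmoothRatio_u {lo : ℝ} (hlo : 0 < lo) (e u : ℝ) :
    HasDerivAt (fun v : ℝ => ppSmoothRatio lo e v)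
      (-(ppSmoothScale lo e * (u / ppSmoothScale lo u)) / (ppSmoothScale lo e + ppSmoothScale lo u) ^ 2) u := by
  have h1 := ppSmoothScale_pos hlo e
  have h2 := ppSmoothScale_pos hlo u
  unfold ppSmoothRatio
  have hD : HasDerivAt (fun v : ℝ => ppSmoothScale lo e + ppSmoothScale lo v) (u / ppSmoothScale lo u) u := by
    simpa using (hasDerivAt_ppSmoothScale hlo u).const_add (ppSmoothScale lo e)
  have h := (hasDerivAt_const u (ppSmoothScale lo e)).div hD (by positivity)
  refine h.congr_deriv ?_
  field_simp
  ring

/-- **`r″(u) = −m̃ₑ·((lo²/m̃ᵤ³)(m̃ₑ+m̃ᵤ) − 2(u/m̃ᵤ)²)/(m̃ₑ+m̃ᵤ)³`.** [folklore] -/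
theorem hasDerivAt_ppSmoothRatioD1_u {lo : ℝ} (hlo : 0 < lo) (e u : ℝ) :
    HasDerivAt (fun v : ℝ => -(ppSmoothScale lo e * (v / ppSmoothScale lo v)) / (ppSmoothScale lo e + ppSmoothScale lo v) ^ 2)
      (-(ppSmoothScale lo e * ((lo ^ 2 / ppSmoothScale lo u ^ 3) * (ppSmoothScale lo e + ppSmoothScale lo u) - 2 * (u / ppSmoothScale lo u) ^ 2)) /
        (ppSmoothScale lo e + ppSmoothScale lo u) ^ 3) u := by
  have h1 := ppSmoothScale_pos hlo e
  have h2 := ppSmoothScale_pos hlo u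
  have hN : HasDerivAt (fun v : ℝ => -(ppSmoothScale lo e * (v / ppSmoothScale lo v))) (-(ppSmoothScale lo e * (lo ^ 2 / ppSmoothScale lo u ^ 3))) u :=
    ((hasDerivAt_div_ppSmoothScale hlo u).const_mul _).neg
  have hD : HasDerivAt (fun v : ℝ => (ppSmoothScale lo e + ppSmoothScale lo v) ^ 2)
      (2 * (ppSmoothScale lo e + ppSmoothScale lo u) * (u / ppSmoothScale lo u)) u := by
    have h0 := ((hasDerivAt_ppSmoothScale hlo u).const_add (ppSmoothScale lo e)).pow 2
    refine h0.congr_deriv ?_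
    simp
  have h := hN.div hD (by positivity)
  refine h.congr_deriv ?_
  field_simp
  ring

/-- `|r′| ≤ 1/(m̃ₑ+m̃ᵤ)`. [folklore] -/
theorem abs_ppSmoothRatioD1_le {lo : ℝ} (hlo : 0 < lo) (e u : ℝ) :
    |-(ppSmoothScale lo e * (u / ppSmoothScale lo u)) / (ppSmoothScale lo e + ppSmoothScale lo u) ^ 2| ≤ 1 / (ppSmoothScale lo e + ppSmoothScale lo u) := by
  have h1 := ppSmoothScale_pos hlo e
  have h2 := ppSmoothScale_pos hlo u
  have hs : 0 < ppSmoothScale lo e + ppSmoothScale lo u := by positivity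
  have hq := abs_div_ppSmoothScale_le_one hlo u
  rw [abs_div, abs_neg, abs_pow, abs_of_pos hs, abs_mul, abs_of_pos h1, div_le_div_iff₀ (pow_pos hs 2) hs]
  calc ppSmoothScale lo e * |u / ppSmoothScale lo u| * (ppSmoothScale lo e + ppSmoothScale lo u)
      ≤ ppSmoothScale lo e * 1 * (ppSmoothScale lo e + ppSmoothScale lo u) := by gcongr
    _ ≤ 1 * (ppSmoothScale lo e + ppSmoothScale lo u) ^ 2 := by nlinarith

/-- `|r″| ≤ (q+2)/(m̃ₑ+m̃ᵤ)²` whenever `m̃ₑ ≤ q·m̃ᵤ`: the floor term `lo²/m̃ᵤ³ ≤ 1/m̃ᵤ ≤ q/m̃ₑ`. [folklore] -/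
theorem abs_ppSmoothRatioD2_le_of_scale {lo : ℝ} (hlo : 0 < lo) {q e u : ℝ} (hsc : ppSmoothScale lo e ≤ q * ppSmoothScale lo u) :
    |-(ppSmoothScale lo e * ((lo ^ 2 / ppSmoothScale lo u ^ 3) * (ppSmoothScale lo e + ppSmoothScale lo u) - 2 * (u / ppSmoothScale lo u) ^ 2)) /
        (ppSmoothScale lo e + ppSmoothScale lo u) ^ 3| ≤ (q + 2) / (ppSmoothScale lo e + ppSmoothScale lo u) ^ 2 := by
  set A := ppSmoothScale lo e with hA
  set B := ppSmoothScale lo u with hB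
  have h1 : 0 < A := ppSmoothScale_pos hlo e
  have h2 : 0 < B := ppSmoothScale_pos hlo u
  have hs : 0 < A + B := by positivity
  have hfl : lo ^ 2 / B ^ 3 ≤ 1 / B := lo_sq_div_ppSmoothScale_cube_le hlo u
  have hfl0 : 0 ≤ lo ^ 2 / B ^ 3 := by positivity
  have hq1 : |u / B| ≤ 1 := abs_div_ppSmoothScale_le_one hlo u
  have hq2 : (u / B) ^ 2 ≤ 1 := by
    have := pow_le_pow_left₀ (abs_nonneg _) hq1 2; rwa [sq_abs, one_pow] at this
  rw [abs_div, abs_neg, abs_pow, abs_of_pos hs, abs_mul, abs_of_pos h1, div_le_div_iff₀ (pow_pos hs 3) (pow_pos hs 2)]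
  have hinner : |lo ^ 2 / B ^ 3 * (A + B) - 2 * (u / B) ^ 2| ≤ 1 / B * (A + B) + 2 := by
    refine (abs_sub _ _).trans ?_
    rw [abs_of_nonneg (by positivity), abs_of_nonneg (by positivity)]
    exact add_le_add (mul_le_mul_of_nonneg_right hfl hs.le) (by linarith)
  -- `A·(1/B)(A+B) ≤ q(A+B)`, since `A ≤ qB`
  have hAB : A * (1 / B * (A + B)) ≤ q * (A + B) := by
    rw [show A * (1 / B * (A + B)) = A / B * (A + B) by ring]
    exact mul_le_mul_of_nonneg_right ((div_le_iff₀ h2).2 hsc) hs.le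
  calc A * |lo ^ 2 / B ^ 3 * (A + B) - 2 * (u / B) ^ 2| * (A + B) ^ 2 ≤ A * (1 / B * (A + B) + 2) * (A + B) ^ 2 := by gcongr
    _ = (A * (1 / B * (A + B)) + 2 * A) * (A + B) ^ 2 := by ring
    _ ≤ (q * (A + B) + 2 * (A + B)) * (A + B) ^ 2 := by gcongr; · linarith
    _ = (q + 2) * (A + B) ^ 3 := by ring

/-- `1/(m̃ₑ+m̃ᵤ) ≤ (max |e| |u|)⁻¹` (`e ≠ 0`). [folklore] -/
theorem inv_ppSmoothScale_add_le_inv_max {lo : ℝ} (hlo : 0 < lo) {e : ℝ} (he : e ≠ 0) (u : ℝ) :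
    1 / (ppSmoothScale lo e + ppSmoothScale lo u) ≤ (max |e| |u|)⁻¹ := by
  have hM : 0 < max |e| |u| := lt_max_of_lt_left (abs_pos.2 he)
  rw [one_div, inv_le_inv₀ (by have := ppSmoothScale_pos hlo e; have := ppSmoothScale_pos hlo u; positivity) hM]
  have h1 := abs_le_ppSmoothScale lo e
  have h2 := abs_le_ppSmoothScale lo u
  have : max |e| |u| ≤ |e| + |u| := max_le (by linarith [abs_nonneg u]) (by linarith [abs_nonneg e])
  linarith

/-! ## §2 The comparable zone -/

/-- `t < r(e,u) ⟺ t·m̃ᵤ < (1−t)·m̃ₑ` (`0 < t < 1` not needed: plain algebra with `m̃ > 0`). [folklore] -/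
theorem ppSmoothRatio_gt_iff {lo : ℝ} (hlo : 0 < lo) (t e u : ℝ) :
    t < ppSmoothRatio lo e u ↔ t * ppSmoothScale lo u < (1 - t) * ppSmoothScale lo e := by
  have h1 := ppSmoothScale_pos hlo e
  have h2 := ppSmoothScale_pos hlo u
  unfold ppSmoothRatio
  rw [lt_div_iff₀ (by positivity)]
  constructor <;> intro h <;> linarith

/-- `r(e,u) < t ⟺ (1−t)·m̃ₑ < t·m̃ᵤ`. [folklore] -/
theorem ppSmoothRatio_lt_iff {lo : ℝ} (hlo : 0 < lo) (t e u : ℝ) :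
    ppSmoothRatio lo e u < t ↔ (1 - t) * ppSmoothScale lo e < t * ppSmoothScale lo u := by
  have h1 := ppSmoothScale_pos hlo e
  have h2 := ppSmoothScale_pos hlo u
  unfold ppSmoothRatio
  rw [div_lt_iff₀ (by positivity)]
  constructor <;> intro h <;> linarith

section Profile

variable {κ κ' κ'' : ℝ → ℝ} {t₁ : ℝ} (ht₀ : 0 < t₁) (ht25 : t₁ ≤ 2 / 5)
  (hκs : ∀ t, t₁ ≤ t → κ t = 0) (hκ's : ∀ t, t₁ ≤ t → κ' t = 0) (hκ''s : ∀ t, t₁ ≤ t → κ'' t = 0)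
  (hκ1 : ∀ t, t ≤ t₁ / 2 → κ t = 1) (hκ'1 : ∀ t, t ≤ t₁ / 2 → κ' t = 0) (hκ''1 : ∀ t, t ≤ t₁ / 2 → κ'' t = 0)
  {lo : ℝ} (hlo : 0 < lo)

include ht₀ hlo in
/-- **Off the comparable zone** (`q′ = (2−t₁)/t₁`): unless `m̃ᵤ < q′m̃ₑ` AND `m̃ₑ < q′m̃ᵤ`, the ratio `r = r(e,u)` satisfies `r ≤ t₁/2 ∧ t₁ ≤ 1 − r` or
`t₁ ≤ r ∧ 1 − r ≤ t₁/2` (`t₁ ≤ 2/3`). [folklore] -/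
theorem ppSmoothRatio_cases_of_not_comparable (ht23 : t₁ ≤ 2 / 3) {e u : ℝ}
    (h : ¬(ppSmoothScale lo u < (2 - t₁) / t₁ * ppSmoothScale lo e ∧ ppSmoothScale lo e < (2 - t₁) / t₁ * ppSmoothScale lo u)) :
    (ppSmoothRatio lo e u ≤ t₁ / 2 ∧ t₁ ≤ 1 - ppSmoothRatio lo e u) ∨ (t₁ ≤ ppSmoothRatio lo e u ∧ 1 - ppSmoothRatio lo e u ≤ t₁ / 2) := by
  have h1 := ppSmoothScale_pos hlo e
  have h2 := ppSmoothScale_pos hlo u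
  set R := ppSmoothRatio lo e u with hR
  have e1 : ∀ x : ℝ, (2 - t₁) / t₁ * x = ((2 - t₁) * x) / t₁ := fun x => by ring
  have hiff1 : t₁ / 2 < R ↔ ppSmoothScale lo u < (2 - t₁) / t₁ * ppSmoothScale lo e := by
    rw [hR, ppSmoothRatio_gt_iff hlo, e1, lt_div_iff₀ ht₀]
    constructor <;> intro h' <;> nlinarith [ht₀]
  have hiff2 : R < 1 - t₁ / 2 ↔ ppSmoothScale lo e < (2 - t₁) / t₁ * ppSmoothScale lo u := by
    rw [hR, ppSmoothRatio_lt_iff hlo, e1, lt_div_iff₀ ht₀]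
    constructor <;> intro h' <;> nlinarith [ht₀]
  rw [← hiff1, ← hiff2, not_and_or, not_lt, not_lt] at h
  rcases h with hlow | hhigh
  · exact Or.inl ⟨hlow, by linarith⟩
  · exact Or.inr ⟨by linarith, by linarith⟩

include ht₀ ht25 hκs hκ's hκ1 hκ'1 hlo in
/-- **Off the comparable zone the factor `1 − κ(r) − κ(1−r)` and `κ′(r), κ′(1−r)` vanish.** [folklore] -/
theorem midFactor_eq_zero_of_not_comparable {e u : ℝ}
    (h : ¬(ppSmoothScale lo u < (2 - t₁) / t₁ * ppSmoothScale lo e ∧ ppSmoothScale lo e < (2 - t₁) / t₁ * ppSmoothScale lo u)) :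
    1 - κ (ppSmoothRatio lo e u) - κ (1 - ppSmoothRatio lo e u) = 0 ∧ κ' (ppSmoothRatio lo e u) = 0 ∧ κ' (1 - ppSmoothRatio lo e u) = 0 := by
  rcases ppSmoothRatio_cases_of_not_comparable ht₀ hlo (by linarith) h with ⟨ha, hb⟩ | ⟨ha, hb⟩
  · refine ⟨?_, hκ'1 _ ha, hκ's _ hb⟩
    rw [hκ1 _ ha, hκs _ hb]; ring
  · refine ⟨?_, hκ's _ ha, hκ'1 _ hb⟩
    rw [hκs _ ha, hκ1 _ hb]; ring

include ht₀ ht25 hκ''s hκ''1 hlo in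
/-- **Off the comparable zone `κ″(r), κ″(1−r)` vanish.** [folklore] -/
theorem midFactorD2_eq_zero_of_not_comparable {e u : ℝ}
    (h : ¬(ppSmoothScale lo u < (2 - t₁) / t₁ * ppSmoothScale lo e ∧ ppSmoothScale lo e < (2 - t₁) / t₁ * ppSmoothScale lo u)) :
    κ'' (ppSmoothRatio lo e u) = 0 ∧ κ'' (1 - ppSmoothRatio lo e u) = 0 := by
  rcases ppSmoothRatio_cases_of_not_comparable ht₀ hlo (by linarith) h with ⟨ha, hb⟩ | ⟨ha, hb⟩
  · exact ⟨hκ''1 _ ha, hκ''s _ hb⟩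
  · exact ⟨hκ''s _ ha, hκ''1 _ hb⟩

include ht₀ ht25 hlo in
/-- **On the comparable zone at a loop level `e ≥ 2q′lo` the partner is not too fine**: `m̃ₑ < q′m̃ᵤ` ⟹ `e/(2q′) ≤ |u|`. [folklore] -/
theorem comparable_abs_lower {e u : ℝ} (he : 2 * ((2 - t₁) / t₁) * lo ≤ e) (hc : ppSmoothScale lo e < (2 - t₁) / t₁ * ppSmoothScale lo u) :
    1 / (2 * ((2 - t₁) / t₁)) * e ≤ |u| := by
  set q : ℝ := (2 - t₁) / t₁ with hq
  have hq4 : 4 ≤ q := by rw [hq, le_div_iff₀ ht₀]; linarith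
  have hq0 : 0 < q := by linarith
  have he0 : 0 ≤ e := le_trans (by positivity) he
  have h2 := ppSmoothScale_pos hlo u
  -- square: `e² + lo² < q²(u² + lo²)`
  have hsq : e ^ 2 + lo ^ 2 < q ^ 2 * (u ^ 2 + lo ^ 2) := by
    have h0 : 0 ≤ ppSmoothScale lo e := (ppSmoothScale_pos hlo e).le
    have := mul_self_lt_mul_self h0 hc
    rw [← sq, ← sq, ppSmoothScale_sq, mul_pow, ppSmoothScale_sq] at this
    exact this
  have hlo2 : lo ^ 2 ≤ e ^ 2 / (4 * q ^ 2) := by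
    rw [le_div_iff₀ (by positivity)]
    have : (2 * q * lo) ^ 2 ≤ e ^ 2 := pow_le_pow_left₀ (by positivity) he 2
    nlinarith
  -- `u² > e²/q² − lo²`: conclude `|u| ≥ e/(2q)`
  have hu2 : (1 / (2 * q) * e) ^ 2 ≤ |u| ^ 2 := by
    rw [sq_abs]
    have e2 : (1 / (2 * q) * e) ^ 2 * (4 * q ^ 2) = e ^ 2 := by field_simp; ring
    have h3 : e ^ 2 ≤ q ^ 2 * u ^ 2 + q ^ 2 * lo ^ 2 := by nlinarith
    have h4 : q ^ 2 * lo ^ 2 ≤ e ^ 2 / 4 := by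
      have := mul_le_mul_of_nonneg_left hlo2 (sq_nonneg q)
      calc q ^ 2 * lo ^ 2 ≤ q ^ 2 * (e ^ 2 / (4 * q ^ 2)) := this
        _ = e ^ 2 / 4 := by field_simp
    nlinarith [sq_nonneg q, e2]
  exact (pow_le_pow_iff_left₀ (by positivity) (abs_nonneg u) two_ne_zero).1 hu2

include ht₀ ht25 hlo in
/-- **A partner at least `2q′×` coarser is off the zone** (`lo ≤ e`, `2q′e ≤ |u|` ⟹ `q′m̃ₑ ≤ m̃ᵤ`). [folklore] -/
theorem not_comparable_of_ge {e u : ℝ} (he : lo ≤ e) (hu : 2 * ((2 - t₁) / t₁) * e ≤ |u|) :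
    ¬(ppSmoothScale lo u < (2 - t₁) / t₁ * ppSmoothScale lo e ∧ ppSmoothScale lo e < (2 - t₁) / t₁ * ppSmoothScale lo u) := by
  set q : ℝ := (2 - t₁) / t₁ with hq
  have hq4 : 4 ≤ q := by rw [hq, le_div_iff₀ ht₀]; linarith
  have he0 : 0 < e := hlo.trans_le he
  rw [not_and_or]; left; rw [not_lt]
  -- `q²(e²+lo²) ≤ u²+lo²`
  have h1 : (q * ppSmoothScale lo e) ^ 2 ≤ ppSmoothScale lo u ^ 2 := by
    rw [mul_pow, ppSmoothScale_sq, ppSmoothScale_sq]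
    have hu2 : (2 * q * e) ^ 2 ≤ u ^ 2 := by rw [← sq_abs u]; exact pow_le_pow_left₀ (by positivity) hu 2
    nlinarith [pow_le_pow_left₀ hlo.le he 2]
  exact (pow_le_pow_iff_left₀ (by have := ppSmoothScale_pos hlo e; positivity) (ppSmoothScale_pos hlo u).le two_ne_zero).1 h1

include ht₀ ht25 hlo in
/-- **A partner at least `2q′×` finer is off the zone** (`2q′lo ≤ e`, `2q′|u| ≤ e` ⟹ `q′m̃ᵤ ≤ m̃ₑ`). [folklore] -/
theorem not_comparable_of_le {e u : ℝ} (he : 2 * ((2 - t₁) / t₁) * lo ≤ e) (hu : 2 * ((2 - t₁) / t₁) * |u| ≤ e) :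
    ¬(ppSmoothScale lo u < (2 - t₁) / t₁ * ppSmoothScale lo e ∧ ppSmoothScale lo e < (2 - t₁) / t₁ * ppSmoothScale lo u) := by
  set q : ℝ := (2 - t₁) / t₁ with hq
  have hq4 : 4 ≤ q := by rw [hq, le_div_iff₀ ht₀]; linarith
  have he0 : 0 ≤ e := le_trans (by positivity) he
  rw [not_and_or]; right; rw [not_lt]
  have h1 : (q * ppSmoothScale lo u) ^ 2 ≤ ppSmoothScale lo e ^ 2 := by
    rw [mul_pow, ppSmoothScale_sq, ppSmoothScale_sq]
    have hu2 : (2 * q * |u|) ^ 2 ≤ e ^ 2 := pow_le_pow_left₀ (by positivity) hu 2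
    have hl2 : (2 * q * lo) ^ 2 ≤ e ^ 2 := pow_le_pow_left₀ (by positivity) he 2
    rw [mul_pow, sq_abs] at hu2
    nlinarith
  exact (pow_le_pow_iff_left₀ (by have := ppSmoothScale_pos hlo u; positivity) (ppSmoothScale_pos hlo e).le two_ne_zero).1 h1

end Profile

/-! ## §3 The two partner derivatives of `M`, `C²`, vanishing off the zone, joint continuity -/

section Derivs

variable {β Λ : ℝ} (hβ : 0 < β) (hΛ : 0 < Λ) {B₁ B₂ : ℝ} (hB₁ : ∀ x, |deriv salmhoferCutoff x| ≤ B₁) (hB₂ : ∀ x, |deriv (deriv salmhoferCutoff) x| ≤ B₂)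
  {κ κ' κ'' : ℝ → ℝ} (hκ : ∀ t, HasDerivAt κ (κ' t) t) (hκ' : ∀ t, HasDerivAt κ' (κ'' t) t) (hκ''c : Continuous κ'')
  {lo : ℝ} (hlo : 0 < lo)

include hβ hΛ hB₁ hκ hlo in
/-- **`M′ = ∂ᵤP·(1 − κ(r) − κ(1−r)) + P·(κ′(1−r) − κ′(r))·r′`.** [cite: BenfattoGiulianiMastropietro2006, §2.4 (2.36)] -/
theorem hasDerivAt_ppMidKernelS_u (e u : ℝ) :
    HasDerivAt (fun v : ℝ => ppMidKernelS β Λ κ lo e v)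
      (ppTrueKernelDu β Λ e u * (1 - κ (ppSmoothRatio lo e u) - κ (1 - ppSmoothRatio lo e u)) +
        ppTrueKernel β Λ e u * ((κ' (1 - ppSmoothRatio lo e u) - κ' (ppSmoothRatio lo e u)) *
          (-(ppSmoothScale lo e * (u / ppSmoothScale lo u)) / (ppSmoothScale lo e + ppSmoothScale lo u) ^ 2))) u := by
  unfold ppMidKernelS
  have hP := hasDerivAt_ppTrueKernel_u hβ hΛ hB₁ e u
  have hr := hasDerivAt_ppSmoothRatio_u hlo e u
  have hk1 : HasDerivAt (fun v : ℝ => κ (ppSmoothRatio lo e v)) (κ' (ppSmoothRatio lo e u) *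
      (-(ppSmoothScale lo e * (u / ppSmoothScale lo u)) / (ppSmoothScale lo e + ppSmoothScale lo u) ^ 2)) u := (hκ _).comp u hr
  have hk2 : HasDerivAt (fun v : ℝ => κ (1 - ppSmoothRatio lo e v)) (κ' (1 - ppSmoothRatio lo e u) *
      (-(-(ppSmoothScale lo e * (u / ppSmoothScale lo u)) / (ppSmoothScale lo e + ppSmoothScale lo u) ^ 2))) u :=
    (hκ _).comp u (hr.const_sub 1)
  have hm := ((hasDerivAt_const u (1 : ℝ)).fun_sub hk1).fun_sub hk2
  have h := hP.fun_mul hm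
  refine h.congr_deriv ?_
  ring

include hβ hΛ hB₁ hκ hlo in
/-- `deriv M(e,·) = M′`. [cite: BenfattoGiulianiMastropietro2006, §2.4 (2.36)] -/
theorem deriv_ppMidKernelS_u (e : ℝ) :
    deriv (fun v : ℝ => ppMidKernelS β Λ κ lo e v) = fun u =>
      ppTrueKernelDu β Λ e u * (1 - κ (ppSmoothRatio lo e u) - κ (1 - ppSmoothRatio lo e u)) +
        ppTrueKernel β Λ e u * ((κ' (1 - ppSmoothRatio lo e u) - κ' (ppSmoothRatio lo e u)) *
          (-(ppSmoothScale lo e * (u / ppSmoothScale lo u)) / (ppSmoothScale lo e + ppSmoothScale lo u) ^ 2)) :=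
  funext fun u => (hasDerivAt_ppMidKernelS_u hβ hΛ hB₁ hκ hlo e u).deriv

include hβ hΛ hB₁ hB₂ hκ hκ' hlo in
/-- **`M″ = ∂ᵤ²P·m + 2∂ᵤP·m′ + P·m″`**, `m = 1 − κ(r) − κ(1−r)`, `m′ = (κ′(1−r) − κ′(r))r′`, `m″ = −(κ″(1−r) + κ″(r))r′² + (κ′(1−r) − κ′(r))r″`.
[cite: BenfattoGiulianiMastropietro2006, §2.4 (2.36)] -/
theorem hasDerivAt_ppMidKernelSD1_u (e u : ℝ) :
    HasDerivAt (fun v : ℝ => ppTrueKernelDu β Λ e v * (1 - κ (ppSmoothRatio lo e v) - κ (1 - ppSmoothRatio lo e v)) +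
        ppTrueKernel β Λ e v * ((κ' (1 - ppSmoothRatio lo e v) - κ' (ppSmoothRatio lo e v)) *
          (-(ppSmoothScale lo e * (v / ppSmoothScale lo v)) / (ppSmoothScale lo e + ppSmoothScale lo v) ^ 2)))
      (ppTrueKernelDuu β Λ e u * (1 - κ (ppSmoothRatio lo e u) - κ (1 - ppSmoothRatio lo e u)) +
        2 * ppTrueKernelDu β Λ e u * ((κ' (1 - ppSmoothRatio lo e u) - κ' (ppSmoothRatio lo e u)) *
          (-(ppSmoothScale lo e * (u / ppSmoothScale lo u)) / (ppSmoothScale lo e + ppSmoothScale lo u) ^ 2)) +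
        ppTrueKernel β Λ e u *
          (-(κ'' (1 - ppSmoothRatio lo e u) + κ'' (ppSmoothRatio lo e u)) *
              (-(ppSmoothScale lo e * (u / ppSmoothScale lo u)) / (ppSmoothScale lo e + ppSmoothScale lo u) ^ 2) ^ 2 +
            (κ' (1 - ppSmoothRatio lo e u) - κ' (ppSmoothRatio lo e u)) *
              (-(ppSmoothScale lo e * ((lo ^ 2 / ppSmoothScale lo u ^ 3) * (ppSmoothScale lo e + ppSmoothScale lo u) - 2 * (u / ppSmoothScale lo u) ^ 2)) /
                (ppSmoothScale lo e + ppSmoothScale lo u) ^ 3))) u := by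
  have hP := hasDerivAt_ppTrueKernel_u hβ hΛ hB₁ e u
  have hP' := hasDerivAt_ppTrueKernelDu_u hβ hΛ hB₁ hB₂ e u
  have hr := hasDerivAt_ppSmoothRatio_u hlo e u
  have hr' := hasDerivAt_ppSmoothRatioD1_u hlo e u
  -- the factor `m` and its derivative
  have hk1 : HasDerivAt (fun v : ℝ => κ (ppSmoothRatio lo e v)) (κ' (ppSmoothRatio lo e u) *
      (-(ppSmoothScale lo e * (u / ppSmoothScale lo u)) / (ppSmoothScale lo e + ppSmoothScale lo u) ^ 2)) u := (hκ _).comp u hr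
  have hk2 : HasDerivAt (fun v : ℝ => κ (1 - ppSmoothRatio lo e v)) (κ' (1 - ppSmoothRatio lo e u) *
      (-(-(ppSmoothScale lo e * (u / ppSmoothScale lo u)) / (ppSmoothScale lo e + ppSmoothScale lo u) ^ 2))) u :=
    (hκ _).comp u (hr.const_sub 1)
  have hm := ((hasDerivAt_const u (1 : ℝ)).fun_sub hk1).fun_sub hk2
  -- the factor `κ′(1−r) − κ′(r)` and its derivative
  have hk1' : HasDerivAt (fun v : ℝ => κ' (ppSmoothRatio lo e v)) (κ'' (ppSmoothRatio lo e u) *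
      (-(ppSmoothScale lo e * (u / ppSmoothScale lo u)) / (ppSmoothScale lo e + ppSmoothScale lo u) ^ 2)) u := (hκ' _).comp u hr
  have hk2' : HasDerivAt (fun v : ℝ => κ' (1 - ppSmoothRatio lo e v)) (κ'' (1 - ppSmoothRatio lo e u) *
      (-(-(ppSmoothScale lo e * (u / ppSmoothScale lo u)) / (ppSmoothScale lo e + ppSmoothScale lo u) ^ 2))) u :=
    (hκ' _).comp u (hr.const_sub 1)
  have hdk := hk2'.fun_sub hk1'
  have hm' := hdk.fun_mul hr'
  have h := (hP'.fun_mul hm).fun_add (hP.fun_mul hm')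
  refine h.congr_deriv ?_
  ring

include hβ hΛ hB₁ hB₂ hκ hκ' hlo in
/-- `iteratedDeriv 2 M(e,·) = M″` (the explicit second derivative). [cite: BenfattoGiulianiMastropietro2006, §2.4 (2.36)] -/
theorem iteratedDeriv_two_ppMidKernelS_u (e u : ℝ) :
    iteratedDeriv 2 (fun v : ℝ => ppMidKernelS β Λ κ lo e v) u =
      ppTrueKernelDuu β Λ e u * (1 - κ (ppSmoothRatio lo e u) - κ (1 - ppSmoothRatio lo e u)) +
        2 * ppTrueKernelDu β Λ e u * ((κ' (1 - ppSmoothRatio lo e u) - κ' (ppSmoothRatio lo e u)) *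
          (-(ppSmoothScale lo e * (u / ppSmoothScale lo u)) / (ppSmoothScale lo e + ppSmoothScale lo u) ^ 2)) +
        ppTrueKernel β Λ e u *
          (-(κ'' (1 - ppSmoothRatio lo e u) + κ'' (ppSmoothRatio lo e u)) *
              (-(ppSmoothScale lo e * (u / ppSmoothScale lo u)) / (ppSmoothScale lo e + ppSmoothScale lo u) ^ 2) ^ 2 +
            (κ' (1 - ppSmoothRatio lo e u) - κ' (ppSmoothRatio lo e u)) *
              (-(ppSmoothScale lo e * ((lo ^ 2 / ppSmoothScale lo u ^ 3) * (ppSmoothScale lo e + ppSmoothScale lo u) - 2 * (u / ppSmoothScale lo u) ^ 2)) /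
                (ppSmoothScale lo e + ppSmoothScale lo u) ^ 3)) := by
  rw [iteratedDeriv_succ, iteratedDeriv_one, deriv_ppMidKernelS_u hβ hΛ hB₁ hκ hlo e]
  exact (hasDerivAt_ppMidKernelSD1_u hβ hΛ hB₁ hB₂ hκ hκ' hlo e u).deriv

include hβ hΛ hB₁ hB₂ hκ hκ' hκ''c hlo in
/-- **`u ↦ M(e,u)` is `C²`** at EVERY loop level `e` — the M-law's `hK` (smooth floor: no kink at `|u| = lo`, no singularity at `u = −e`).
[cite: BenfattoGiulianiMastropietro2006, §2.4 (2.36)] -/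
theorem contDiff_two_ppMidKernelS_u (e : ℝ) : ContDiff ℝ 2 (fun v : ℝ => ppMidKernelS β Λ κ lo e v) := by
  unfold ppMidKernelS
  have hP := contDiff_two_ppTrueKernel_u hβ hΛ hB₁ hB₂ e
  have hκ2 : ContDiff ℝ 2 κ := contDiff_two_of_hasDerivAt₂ hκ hκ' hκ''c
  have hr : ContDiff ℝ 2 (fun v : ℝ => ppSmoothRatio lo e v) := contDiff_ppSmoothRatio hlo e
  exact hP.mul ((contDiff_const.sub (hκ2.comp hr)).sub (hκ2.comp (contDiff_const.sub hr)))

end Derivs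

end Summit.HubbardSuperconductivity.HubbardSuperconductivity.Theorems.C4a

end
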